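import Summits.AtomisticToContinuum.Crystallization.Theorems.OverbindingBudgetAffineTaylorCellIntKernel

/-!
# OverbindingBudget — Taylor-model cells for the far-window certificate, part 13/16 «OrderFiveA»

MODULE PLAN (lens-4 g68, at hand-2's landing-shape request of 2026-09-02T14:19Z, critic row 1199 (II)) of the VERIFIED g67 leaf
`OverbindingBudgetAffineTaylorCell.lean` (sha256 `dabedef39e0c5fd2…`, 4214 l, critic row 1196): this module = leaf l.3303–3479
(§10 order-5 twin: term models, remainders, model sums (first half)), body VERBATIM except as listed in `MAP.md`.
Same namespace `…Theorems.OverbindingBudgetAffineTaylorCell` in all 16 parts (declaration names unchanged); the parts import each other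
linearly.  No `sorry`, no `native_decide`, standard axioms; no instances/notation; scoped `set_option maxHeartbeats` with explicit bounds only.
-/

namespace Summit.AtomisticToContinuum.Crystallization.Theorems.OverbindingBudgetAffineTaylorCell

/-! ## §10 The order-`J = 5` twin (all 126 slots active, sextic remainder `U⁵N₅(U)/(1−U)^m`)

Additive twin of §4/§8 for rows with `C.J = 5` — the format the measured budget (NODE memo §0 ‡‡) makes load-bearing: at `J = 4` the
first-shell remainder `≈ 126·(3.5h)⁴·12·A` caps every half-width at `1/70–1/130`; at `J = 5` the remainder stops binding.  Same kernel
(`Cell.acc`, `CellZ`), same slot product / `LDLᵀ` / margin; only the per-term model gains the quartic slots and the remainder changes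
order.  `CertRow.check5` / `check5_sound` are the row check and its soundness. -/

/-- The exact order-5 model of one term: `Σ_{deg α < 5} termQ(α) t^α` (all 126 slots). -/
def Cell.termModel5 (C : Cell) (x y z : ℚ) (t1 t2 t3 t4 t5 : ℝ) : ℝ :=
  (monos.map fun mo => (if mo.d < 5 then (C.termQ x y z mo : ℝ) else 0) * mo.ev t1 t2 t3 t4 t5).sum

/-- `tcoef_three_4` (docstring added by the landing lane; see the module docstring). [formal bookkeeping] -/
theorem tcoef_three_4 : tcoef 3 4 = 15 := by norm_num [tcoef, Nat.choose]
/-- `tcoef_six_4` (docstring added by the landing lane; see the module docstring). [formal bookkeeping] -/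
theorem tcoef_six_4 : tcoef 6 4 = 126 := by norm_num [tcoef, Nat.choose]

set_option maxHeartbeats 8000000 in
/-- MULTINOMIAL REGROUPING, order 5 (`m = 3`): the slot polynomial IS `c^{-3} T_5(ℓ(t)/c)`. -/
theorem Cell.termModel5_eq_m3 (C : Cell) (hm : C.m = 3) (x y z : ℚ) (hc : C.cOf x y z ≠ 0) (t1 t2 t3 t4 t5 : ℝ) :
    C.termModel5 x y z t1 t2 t3 t4 t5 =
      ((C.cOf x y z : ℝ) ^ 3)⁻¹ * (1 - 3 * (C.linR x y z t1 t2 t3 t4 t5 / C.cOf x y z)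
        + 6 * (C.linR x y z t1 t2 t3 t4 t5 / C.cOf x y z) ^ 2 - 10 * (C.linR x y z t1 t2 t3 t4 t5 / C.cOf x y z) ^ 3
        + 15 * (C.linR x y z t1 t2 t3 t4 t5 / C.cOf x y z) ^ 4) := by
  have hc' : (C.cOf x y z : ℝ) ≠ 0 := by exact_mod_cast hc
  simp only [Cell.termModel5, monos, List.map_cons, List.map_nil, List.sum_cons, List.sum_nil, Cell.termQ, hm, Mono.ev,
    Cell.linR, tcoef_three_0, tcoef_three_1, tcoef_three_2, tcoef_three_3, tcoef_three_4, Nat.reduceAdd, Nat.reduceLT, if_true,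
    Nat.cast_ofNat, Nat.cast_one, Rat.cast_mul, Rat.cast_pow, Rat.cast_div, Rat.cast_one, Rat.cast_ofNat, Rat.cast_neg,
    pow_zero, pow_one, mul_one, one_mul, add_zero]
  field_simp
  ring

set_option maxHeartbeats 8000000 in
/-- MULTINOMIAL REGROUPING, order 5 (`m = 6`). -/
theorem Cell.termModel5_eq_m6 (C : Cell) (hm : C.m = 6) (x y z : ℚ) (hc : C.cOf x y z ≠ 0) (t1 t2 t3 t4 t5 : ℝ) :
    C.termModel5 x y z t1 t2 t3 t4 t5 =
      ((C.cOf x y z : ℝ) ^ 6)⁻¹ * (1 - 6 * (C.linR x y z t1 t2 t3 t4 t5 / C.cOf x y z)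
        + 21 * (C.linR x y z t1 t2 t3 t4 t5 / C.cOf x y z) ^ 2 - 56 * (C.linR x y z t1 t2 t3 t4 t5 / C.cOf x y z) ^ 3
        + 126 * (C.linR x y z t1 t2 t3 t4 t5 / C.cOf x y z) ^ 4) := by
  have hc' : (C.cOf x y z : ℝ) ≠ 0 := by exact_mod_cast hc
  simp only [Cell.termModel5, monos, List.map_cons, List.map_nil, List.sum_cons, List.sum_nil, Cell.termQ, hm, Mono.ev,
    Cell.linR, tcoef_six_0, tcoef_six_1, tcoef_six_2, tcoef_six_3, tcoef_six_4, Nat.reduceAdd, Nat.reduceLT, if_true,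
    Nat.cast_ofNat, Nat.cast_one, Rat.cast_mul, Rat.cast_pow, Rat.cast_div, Rat.cast_one, Rat.cast_ofNat, Rat.cast_neg,
    pow_zero, pow_one, mul_one, one_mul, add_zero]
  field_simp
  ring


/-- `term_model5_m3_abs` (docstring added by the landing lane; see the module docstring). [formal bookkeeping] -/
theorem term_model5_m3_abs {c ℓ η : ℝ} (hc : 0 < c) (hη : η < 1) (hu : |ℓ / c| ≤ η) :
    |((c + ℓ) ^ 3)⁻¹ - (c ^ 3)⁻¹ * (1 - 3 * (ℓ / c) + 6 * (ℓ / c) ^ 2 - 10 * (ℓ / c) ^ 3 + 15 * (ℓ / c) ^ 4)|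
      ≤ (c ^ 3)⁻¹ * (|ℓ / c| ^ 5 * (21 + 35 * η + 15 * η ^ 2) / (1 - η) ^ 3) := by
  have hc3 : 0 < (c ^ 3)⁻¹ := by positivity
  have hsplit : ((c + ℓ) ^ 3)⁻¹ = (c ^ 3)⁻¹ * ((1 + ℓ / c) ^ 3)⁻¹ := by
    rw [← mul_inv, ← mul_pow]; congr 2; field_simp
  rw [hsplit, ← mul_sub, abs_mul, abs_of_pos hc3]
  exact mul_le_mul_of_nonneg_left (inv_pow_three_model5_abs hη hu) hc3.le

/-- `term_model5_m6_abs` (docstring added by the landing lane; see the module docstring). [formal bookkeeping] -/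
theorem term_model5_m6_abs {c ℓ η : ℝ} (hc : 0 < c) (hη : η < 1) (hu : |ℓ / c| ≤ η) :
    |((c + ℓ) ^ 6)⁻¹ - (c ^ 6)⁻¹ * (1 - 6 * (ℓ / c) + 21 * (ℓ / c) ^ 2 - 56 * (ℓ / c) ^ 3 + 126 * (ℓ / c) ^ 4)|
      ≤ (c ^ 6)⁻¹ * (|ℓ / c| ^ 5 * (252 + 1050 * η + 1800 * η ^ 2 + 1575 * η ^ 3 + 700 * η ^ 4 + 126 * η ^ 5)
          / (1 - η) ^ 6) := by
  have hc6 : 0 < (c ^ 6)⁻¹ := by positivity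
  have hsplit : ((c + ℓ) ^ 6)⁻¹ = (c ^ 6)⁻¹ * ((1 + ℓ / c) ^ 6)⁻¹ := by
    rw [← mul_inv, ← mul_pow]; congr 2; field_simp
  rw [hsplit, ← mul_sub, abs_mul, abs_of_pos hc6]
  exact mul_le_mul_of_nonneg_left (inv_pow_six_model5_abs hη hu) hc6.le

/-- PER-TERM ENCLOSURE (`m = 3`, `J = 5`): on the box, the true term is within `remQ` of its slot polynomial. -/
theorem Cell.term_abs5_m3 (C : Cell) (hm : C.m = 3) (hJ : C.J = 5) (x y z : ℚ) (hc : 0 < C.cOf x y z)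
    (hU : C.UOf x y z < 1 / 2) (t1 t2 t3 t4 t5 : ℝ)
    (h1 : |t1| ≤ C.h1) (h2 : |t2| ≤ C.h2) (h3 : |t3| ≤ C.h3) (h4 : |t4| ≤ C.h4) (h5 : |t5| ≤ C.h5) :
    |(((C.cOf x y z : ℝ) + C.linR x y z t1 t2 t3 t4 t5) ^ 3)⁻¹ - C.termModel5 x y z t1 t2 t3 t4 t5| ≤ (C.remQ x y z : ℝ) := by
  rw [C.termModel5_eq_m3 hm x y z hc.ne' t1 t2 t3 t4 t5]
  have hc' : (0 : ℝ) < C.cOf x y z := by exact_mod_cast hc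
  have hu := C.linR_div_abs_le x y z hc t1 t2 t3 t4 t5 h1 h2 h3 h4 h5
  have hU' : ((C.UOf x y z : ℚ) : ℝ) < 1 / 2 := by
    have := (Rat.cast_lt (K := ℝ)).2 hU
    simpa using this
  have hη : ((C.UOf x y z : ℚ) : ℝ) < 1 := by linarith
  have hU0 : (0 : ℝ) ≤ C.UOf x y z := (abs_nonneg _).trans hu
  have key := term_model5_m3_abs hc' hη hu
  refine key.trans ?_
  have hrem : ((C.remQ x y z : ℚ) : ℝ) = ((C.cOf x y z : ℝ) ^ 3)⁻¹
      * ((C.UOf x y z : ℝ) ^ 5 * (21 + 35 * (C.UOf x y z : ℝ) + 15 * (C.UOf x y z : ℝ) ^ 2)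
        / (1 - (C.UOf x y z : ℝ)) ^ 3) := by
    unfold Cell.remQ
    rw [hm, hJ]
    simp only [remNum]
    push_cast
    ring
  rw [hrem]
  have h4' : |C.linR x y z t1 t2 t3 t4 t5 / C.cOf x y z| ^ 5 ≤ (C.UOf x y z : ℝ) ^ 5 := pow_le_pow_left₀ (abs_nonneg _) hu 5
  have hN : (0 : ℝ) ≤ 21 + 35 * (C.UOf x y z : ℝ) + 15 * (C.UOf x y z : ℝ) ^ 2 := by nlinarith
  have hd : (0 : ℝ) < (1 - (C.UOf x y z : ℝ)) ^ 3 := pow_pos (by linarith) 3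
  exact mul_le_mul_of_nonneg_left (div_le_div_of_nonneg_right (mul_le_mul_of_nonneg_right h4' hN) hd.le) (by positivity)

/-- PER-TERM ENCLOSURE (`m = 6`, `J = 5`). -/
theorem Cell.term_abs5_m6 (C : Cell) (hm : C.m = 6) (hJ : C.J = 5) (x y z : ℚ) (hc : 0 < C.cOf x y z)
    (hU : C.UOf x y z < 1 / 2) (t1 t2 t3 t4 t5 : ℝ)
    (h1 : |t1| ≤ C.h1) (h2 : |t2| ≤ C.h2) (h3 : |t3| ≤ C.h3) (h4 : |t4| ≤ C.h4) (h5 : |t5| ≤ C.h5) :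
    |(((C.cOf x y z : ℝ) + C.linR x y z t1 t2 t3 t4 t5) ^ 6)⁻¹ - C.termModel5 x y z t1 t2 t3 t4 t5| ≤ (C.remQ x y z : ℝ) := by
  rw [C.termModel5_eq_m6 hm x y z hc.ne' t1 t2 t3 t4 t5]
  have hc' : (0 : ℝ) < C.cOf x y z := by exact_mod_cast hc
  have hu := C.linR_div_abs_le x y z hc t1 t2 t3 t4 t5 h1 h2 h3 h4 h5
  have hU' : ((C.UOf x y z : ℚ) : ℝ) < 1 / 2 := by
    have := (Rat.cast_lt (K := ℝ)).2 hU
    simpa using this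
  have hη : ((C.UOf x y z : ℚ) : ℝ) < 1 := by linarith
  have hU0 : (0 : ℝ) ≤ C.UOf x y z := (abs_nonneg _).trans hu
  have key := term_model5_m6_abs hc' hη hu
  refine key.trans ?_
  have hrem : ((C.remQ x y z : ℚ) : ℝ) = ((C.cOf x y z : ℝ) ^ 6)⁻¹
      * ((C.UOf x y z : ℝ) ^ 5 * (252 + 1050 * (C.UOf x y z : ℝ) + 1800 * (C.UOf x y z : ℝ) ^ 2
          + 1575 * (C.UOf x y z : ℝ) ^ 3 + 700 * (C.UOf x y z : ℝ) ^ 4 + 126 * (C.UOf x y z : ℝ) ^ 5)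
        / (1 - (C.UOf x y z : ℝ)) ^ 6) := by
    unfold Cell.remQ
    rw [hm, hJ]
    simp only [remNum]
    push_cast
    ring
  rw [hrem]
  have h4' : |C.linR x y z t1 t2 t3 t4 t5 / C.cOf x y z| ^ 5 ≤ (C.UOf x y z : ℝ) ^ 5 := pow_le_pow_left₀ (abs_nonneg _) hu 5
  have hN : (0 : ℝ) ≤ 252 + 1050 * (C.UOf x y z : ℝ) + 1800 * (C.UOf x y z : ℝ) ^ 2
      + 1575 * (C.UOf x y z : ℝ) ^ 3 + 700 * (C.UOf x y z : ℝ) ^ 4 + 126 * (C.UOf x y z : ℝ) ^ 5 := by positivity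
  have hd : (0 : ℝ) < (1 - (C.UOf x y z : ℝ)) ^ 6 := pow_pos (by linarith) 6
  exact mul_le_mul_of_nonneg_left (div_le_div_of_nonneg_right (mul_le_mul_of_nonneg_right h4' hN) hd.le) (by positivity)


/-- The exact order-5 model of the family. -/
def Cell.modelSum5 (C : Cell) (vs : List (ℤ × ℤ × ℤ)) (t1 t2 t3 t4 t5 : ℝ) : ℝ :=
  (vs.map fun N => C.termModel5 N.1 N.2.1 N.2.2 t1 t2 t3 t4 t5).sum

/-- `Cell.modelSum5_cons` (docstring added by the landing lane; see the module docstring). [formal bookkeeping] -/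
theorem Cell.modelSum5_cons (C : Cell) (N : ℤ × ℤ × ℤ) (vs : List (ℤ × ℤ × ℤ)) (t1 t2 t3 t4 t5 : ℝ) :
    C.modelSum5 (N :: vs) t1 t2 t3 t4 t5 = C.termModel5 N.1 N.2.1 N.2.2 t1 t2 t3 t4 t5 + C.modelSum5 vs t1 t2 t3 t4 t5 := by
  simp [Cell.modelSum5]

/-- `Cell.trueSum_sub_modelSum5_m3` (docstring added by the landing lane; see the module docstring). [formal bookkeeping] -/
theorem Cell.trueSum_sub_modelSum5_m3 (C : Cell) (hm : C.m = 3) (hJ : C.J = 5) (hD : 0 < C.D) (t1 t2 t3 t4 t5 : ℝ)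
    (h1 : |t1| ≤ C.h1) (h2 : |t2| ≤ C.h2) (h3 : |t3| ≤ C.h3) (h4 : |t4| ≤ C.h4) (h5 : |t5| ≤ C.h5) :
    ∀ vs : List (ℤ × ℤ × ℤ), (∀ N ∈ vs, 0 < C.cOf N.1 N.2.1 N.2.2 ∧ C.UOf N.1 N.2.1 N.2.2 < 1 / 2) →
      |C.trueSum 3 vs t1 t2 t3 t4 t5 - C.modelSum5 vs t1 t2 t3 t4 t5| ≤ ((vs.map C.rr).sum : ℚ) := by
  intro vs
  induction vs with
  | nil => intro _; simp [Cell.trueSum, Cell.modelSum5]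
  | cons N vs ih =>
    intro hadm
    have hN := hadm N (by simp)
    have hrest := ih (fun M hM => hadm M (by simp [hM]))
    rw [C.trueSum_cons, C.modelSum5_cons, List.map_cons, List.sum_cons, Rat.cast_add]
    have hterm := C.term_abs5_m3 hm hJ (N.1 : ℚ) (N.2.1 : ℚ) (N.2.2 : ℚ) hN.1 hN.2 t1 t2 t3 t4 t5 h1 h2 h3 h4 h5
    have hrr : ((C.remQ N.1 N.2.1 N.2.2 : ℚ) : ℝ) ≤ ((C.rr N : ℚ) : ℝ) := by exact_mod_cast C.le_rr hD hN.1
    calc |(((C.cOf N.1 N.2.1 N.2.2 : ℝ) + C.linR N.1 N.2.1 N.2.2 t1 t2 t3 t4 t5) ^ 3)⁻¹ + C.trueSum 3 vs t1 t2 t3 t4 t5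
          - (C.termModel5 N.1 N.2.1 N.2.2 t1 t2 t3 t4 t5 + C.modelSum5 vs t1 t2 t3 t4 t5)|
        = |((((C.cOf N.1 N.2.1 N.2.2 : ℝ) + C.linR N.1 N.2.1 N.2.2 t1 t2 t3 t4 t5) ^ 3)⁻¹
            - C.termModel5 N.1 N.2.1 N.2.2 t1 t2 t3 t4 t5)
            + (C.trueSum 3 vs t1 t2 t3 t4 t5 - C.modelSum5 vs t1 t2 t3 t4 t5)| := by ring_nf
      _ ≤ _ := abs_add_le _ _
      _ ≤ _ := add_le_add (hterm.trans hrr) hrest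

/-- `Cell.trueSum_sub_modelSum5_m6` (docstring added by the landing lane; see the module docstring). [formal bookkeeping] -/
theorem Cell.trueSum_sub_modelSum5_m6 (C : Cell) (hm : C.m = 6) (hJ : C.J = 5) (hD : 0 < C.D) (t1 t2 t3 t4 t5 : ℝ)
    (h1 : |t1| ≤ C.h1) (h2 : |t2| ≤ C.h2) (h3 : |t3| ≤ C.h3) (h4 : |t4| ≤ C.h4) (h5 : |t5| ≤ C.h5) :
    ∀ vs : List (ℤ × ℤ × ℤ), (∀ N ∈ vs, 0 < C.cOf N.1 N.2.1 N.2.2 ∧ C.UOf N.1 N.2.1 N.2.2 < 1 / 2) →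
      |C.trueSum 6 vs t1 t2 t3 t4 t5 - C.modelSum5 vs t1 t2 t3 t4 t5| ≤ ((vs.map C.rr).sum : ℚ) := by
  intro vs
  induction vs with
  | nil => intro _; simp [Cell.trueSum, Cell.modelSum5]
  | cons N vs ih =>
    intro hadm
    have hN := hadm N (by simp)
    have hrest := ih (fun M hM => hadm M (by simp [hM]))
    rw [C.trueSum_cons, C.modelSum5_cons, List.map_cons, List.sum_cons, Rat.cast_add]
    have hterm := C.term_abs5_m6 hm hJ (N.1 : ℚ) (N.2.1 : ℚ) (N.2.2 : ℚ) hN.1 hN.2 t1 t2 t3 t4 t5 h1 h2 h3 h4 h5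
    have hrr : ((C.remQ N.1 N.2.1 N.2.2 : ℚ) : ℝ) ≤ ((C.rr N : ℚ) : ℝ) := by exact_mod_cast C.le_rr hD hN.1
    calc |(((C.cOf N.1 N.2.1 N.2.2 : ℝ) + C.linR N.1 N.2.1 N.2.2 t1 t2 t3 t4 t5) ^ 6)⁻¹ + C.trueSum 6 vs t1 t2 t3 t4 t5
          - (C.termModel5 N.1 N.2.1 N.2.2 t1 t2 t3 t4 t5 + C.modelSum5 vs t1 t2 t3 t4 t5)|
        = |((((C.cOf N.1 N.2.1 N.2.2 : ℝ) + C.linR N.1 N.2.1 N.2.2 t1 t2 t3 t4 t5) ^ 6)⁻¹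
            - C.termModel5 N.1 N.2.1 N.2.2 t1 t2 t3 t4 t5)
            + (C.trueSum 6 vs t1 t2 t3 t4 t5 - C.modelSum5 vs t1 t2 t3 t4 t5)| := by ring_nf
      _ ≤ _ := abs_add_le _ _
      _ ≤ _ := add_le_add (hterm.trans hrr) hrest

end Summit.AtomisticToContinuum.Crystallization.Theorems.OverbindingBudgetAffineTaylorCell
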